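import Literature.AlgebraicGeometry.Frobenioids.Thm36SubPerfectionUnits
import Mathlib.Analysis.Real.Pi.Irrational
import HarnessLib

/-!
# Frobenioids II, Thm. 3.6 (v) for `C^ℚ := C^pf` — PROVED over THE perfection: `O^×((A, n))` is trivial for
# `A` real and `≅ S¹ ⊗_ℤ ℚ` (nontrivial, torsion-free) for `A` complex (part 2 of 2; slot `Thm36Sub.v_Q`)

Mochizuki, *The geometry of Frobenioids II: poly-Frobenioids*, Kyushu J. Math. **62** (2008) 401–460, §3,
Thm. 3.6 (v) p. 37 (kurims text `paper:url-4322d76898e0`): "Let `A ∈ Ob(F)`. Then the group `O^×(A)` is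
trivial if and only if one of the following holds: (a) `Λ = ℤ` and `A` is complex non-isotropic; (b) `Λ = ℚ`
and `A` is real; (c) `Λ = ℝ`. The group `O^×(A)` is nontrivial and torsion free [and in fact isomorphic to
`S¹ ⊗_ℤ ℚ`] if and only if `Λ = ℚ` and `A` is complex. The group `O^×(A)` is of order two if and only if
`Λ = ℤ` and `A` is real. The group `O^×(A)` has infinitely many torsion elements [and is in fact isomorphic to
`S¹`] if and only if `Λ = ℤ` and `A` is complex isotropic." — for `F = C^ℚ := C^pf` (Ex. 3.3 (ii) p. 28), THE
perfection of the archimedean Frobenioid `C → F_Φ` over any base `π : D → D₀` [cite: MochizukiFrdII2008, Thm 3.6 (v) p.37].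

PROOF-ONLY companion, part 2 (abc-iut cell, layer L1, `SUBDAG-FrdII-Thm36-Prop35`; seat abc-iut-w5-d237, roadmap
of abc-iut-w4-d027), over part 1 `Thm36SubPerfectionUnits.lean` (`O^×((A, n)) = lim_→ (O^×(A^{(c)}), z ↦ z^{c′/c})`
on normalised scalars; real case).  Here, for `X = (A, n)`:
* the equality criterion of the inductive limit for units, `[θ] = 1 ⟺ ns(θ)^k = 1` for some `k ≥ 1`
  (`classAut_eq_one_iff`), whence `O^×(X)` is TORSION-FREE (`eq_one_of_isOfFinOrder`) and, for `A` complex,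
  NONTRIVIAL (`unitsSubgroup_ne_bot_of_isComplex`: the unit with scalar `exp(i)` at a naively isotropic Frobenius
  power — `exp(i)` has infinite order since `π` is irrational, Mathlib `irrational_pi`);
* the value map `[θ] ↦ ns(θ) ⊗ 1/c`, `O^×(X) → S¹ ⊗_ℤ ℚ` (Mathlib `Additive Circle ⊗[ℤ] ℚ`) is well defined,
  additive, injective (the kernel of `M → M ⊗_ℤ ℚ` is torsion: `M → ℚ ⊗_ℤ M` is a localisation of `ℤ`-modules,
  Mathlib `IsLocalizedModule.eq_zero_iff`) and surjective (`y ⊗ 1/b` is the value of the unit with normalised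
  scalar `y^{n₀}` at the naively isotropic level `b n₀`), i.e. **`O^×(X) ≅ S¹ ⊗_ℤ ℚ` for `A` complex**;
* **`v_Q_holds`**: all six clauses of Thm. 3.6 (v) at `Λ = ℚ` over THE perfection — closes the slot `Thm36Sub.v_Q`
  (for every value of its parameter `hF`, the input "`C` is a Frobenioid" of the construction of `C^pf`), i.e.
  the `Λ = ℚ` conjunct of abc-iut-L1-t9's instance `Thm36v_C` at `pf := pfCompletion hF` (`thm36v_instance_Q`).
Theorems only; no statement of the paper is restated or strengthened; nothing here bears on [IUTchIII] Cor. 3.12.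
-/

noncomputable section

namespace Literature.AlgebraicGeometry.Frobenioids

open CategoryTheory Opposite
open scoped TensorProduct

universe v u

namespace ArchFrd

namespace Thm36Sub

/-! ### Mathlib-level tools: norm-one units as points of `S¹`; torsion in `M ⊗_ℤ ℚ`; a point of
infinite order on `S¹` -/

/-- In `M ⊗_ℤ ℚ`: `x ⊗ b⁻¹ = (m·x) ⊗ (bm)⁻¹`. [cite: MochizukiFrdII2008, Thm 3.6 (v) p.37] -/
theorem tmul_inv_eq_smul_tmul_inv {M : Type*} [AddCommGroup M] (x : M) (b m : ℕ+) :
    (x ⊗ₜ[ℤ] ((b : ℚ)⁻¹) : M ⊗[ℤ] ℚ) = ((m : ℤ) • x) ⊗ₜ[ℤ] (((b * m : ℕ+) : ℚ)⁻¹) := by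
  rw [TensorProduct.smul_tmul]
  congr 1
  rw [zsmul_eq_mul, PNat.mul_coe, Nat.cast_mul, mul_inv, Int.cast_natCast]
  have hm : (m : ℚ) ≠ 0 := by exact_mod_cast m.ne_zero
  field_simp

/-- In `M ⊗_ℤ ℚ`: `(n·x) ⊗ q = x ⊗ (n·q)`. [cite: MochizukiFrdII2008, Thm 3.6 (v) p.37] -/
theorem zsmul_tmul_eq {M : Type*} [AddCommGroup M] (x : M) (n : ℤ) (q : ℚ) :
    ((n • x) ⊗ₜ[ℤ] q : M ⊗[ℤ] ℚ) = x ⊗ₜ[ℤ] (n * q) := by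
  rw [TensorProduct.smul_tmul, zsmul_eq_mul]

/-- **The kernel of `M → M ⊗_ℤ ℚ` is torsion**: if `x ⊗ q = 0` with `q ≠ 0` then `N · x = 0` for some
`N ≥ 1` (`M → ℚ ⊗_ℤ M` is a localisation of `ℤ`-modules at `ℤ ∖ 0`, Mathlib
`IsLocalizedModule.eq_zero_iff`). [cite: MochizukiFrdII2008, Thm 3.6 (v) p.37] -/
theorem exists_pnat_smul_eq_zero_of_tmul_eq_zero {M : Type*} [AddCommGroup M] (x : M) {q : ℚ}
    (hq : q ≠ 0) (h : (x ⊗ₜ[ℤ] q : M ⊗[ℤ] ℚ) = 0) : ∃ N : ℕ+, (N : ℤ) • x = 0 := by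
  have h1 : (q ⊗ₜ[ℤ] x : ℚ ⊗[ℤ] M) = 0 := by
    have := congrArg (TensorProduct.comm ℤ M ℚ) h
    rwa [TensorProduct.comm_tmul, map_zero] at this
  have h2 : (TensorProduct.mk ℤ ℚ M 1) x = 0 := by
    change ((1 : ℚ) ⊗ₜ[ℤ] x : ℚ ⊗[ℤ] M) = 0
    have : q⁻¹ • (q ⊗ₜ[ℤ] x : ℚ ⊗[ℤ] M) = (1 : ℚ) ⊗ₜ[ℤ] x := by
      rw [TensorProduct.smul_tmul', smul_eq_mul, inv_mul_cancel₀ hq]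
    rw [← this, h1, smul_zero]
  obtain ⟨⟨s, hs⟩, hsx⟩ :=
    (IsLocalizedModule.eq_zero_iff (nonZeroDivisors ℤ) (TensorProduct.mk ℤ ℚ M 1)).mp h2
  have hs0 : s ≠ 0 := nonZeroDivisors.ne_zero hs
  have hsx' : s • x = 0 := hsx
  refine ⟨⟨s.natAbs, Int.natAbs_pos.mpr hs0⟩, ?_⟩
  change ((s.natAbs : ℕ) : ℤ) • x = 0
  rcases Int.natAbs_eq s with h' | h'
  · rw [← h']; exact hsx'
  · have : ((s.natAbs : ℕ) : ℤ) = -s := by omega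
    rw [this, neg_smul, hsx', neg_zero]

/-- **A point of infinite order on `S¹`**: `exp(i)` is not a root of unity (`π` is irrational). [cite: MochizukiFrdII2008, Thm 3.6 (v) p.37] -/
theorem circleExp_one_pow_ne_one (k : ℕ) (hk : 0 < k) : Circle.exp 1 ^ k ≠ 1 := by
  intro h
  rw [← circleExp_nat_mul, mul_one, Circle.exp_eq_one] at h
  obtain ⟨m, hm⟩ := h
  have hm0 : (m : ℝ) ≠ 0 := by
    intro h0
    rw [h0, zero_mul] at hm
    exact (Nat.cast_pos.mpr hk).ne' hm
  have hpi : Real.pi = ((k : ℚ) / (2 * m) : ℚ) := by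
    push_cast
    field_simp
    linarith
  exact irrational_pi.ne_rat _ hpi

section Complex

variable {D : Type u} [Category.{v} D] {π : D ⥤ D0}
variable {hF : PreFrobenioid.IsFrobenioid (C.toElem π)} (X : pfCat π hF)

open PreFrobenioid PreFrobenioid.Perfection

/-! ### Classes and powers -/

/-- The normalised scalar commutes with powers. [cite: MochizukiFrdII2008, Thm 3.6 (v) p.37] -/
theorem normScalar_pow (c : ℕ+) (θ : Aut (frobPow hF X.obj c))
    (hθ : θ ∈ unitsSubgroup (C.toElem π) (frobPow hF X.obj c)) (n : ℕ) :
    normScalar X c (θ ^ n) = normScalar X c θ ^ n := by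
  induction n with
  | zero => rw [pow_zero, pow_zero, normScalar_one]
  | succ n ih => rw [pow_succ, pow_succ, normScalar_mul X c _ _ (pow_mem hθ n) hθ, ih]

/-- A power of the normalised scalar is `1` iff the same power of the scalar is `1`. [cite: MochizukiFrdII2008, Thm 3.6 (v) p.37] -/
theorem normScalar_pow_eq_one_iff (c : ℕ+) (θ : Aut (frobPow hF X.obj c)) (k : ℕ) :
    normScalar X c θ ^ k = 1 ↔ C0.scalar θ.hom.fst ^ k = 1 := by
  rw [normScalar, ← map_pow, EmbeddingLike.map_eq_one_iff]

/-- **The equality criterion of the inductive limit, for units**: `[θ] = 1` in `O^×((A, n))` iff some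
power `ns(θ)^k`, `k ≥ 1`, of the normalised scalar is `1`. [cite: MochizukiFrdII2008, Thm 3.6 (v) p.37] -/
theorem classAut_eq_one_iff (c : ℕ+) (θ : Aut (frobPow hF X.obj c))
    (hθ : θ ∈ unitsSubgroup (C.toElem π) (frobPow hF X.obj c)) :
    classAut X c θ = 1 ↔ ∃ k : ℕ+, normScalar X c θ ^ (k : ℕ) = 1 := by
  constructor
  · intro h1
    have h := congrArg Iso.hom h1
    change endClass X c θ.hom = 𝟙 X at h
    rw [← endClass_id X c] at h
    obtain ⟨c'', hc, hc', e⟩ := (endClass_eq_iff X θ.hom (𝟙 _)).mp h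
    rw [liftLevel_id] at e
    have e' : liftUnit X hc θ = 1 := Iso.ext e
    refine ⟨C0.degFr (frobTrans hF X.obj hc).fst, ?_⟩
    rw [← normScalar_liftUnit X hc θ hθ, e', normScalar_one]
  · rintro ⟨k, hk⟩
    exact classAut_eq_one_of_pow_eq_one X c θ hθ k ((normScalar_pow_eq_one_iff X c θ k).mp hk)

/-! ### Complex objects: `O^×((A, n))` is torsion-free and nontrivial -/

/-- **Over any `A`, `O^×((A, n))` is torsion-free**: a torsion unit is the class of a unit `θ` with
`[θ]^N = [θ^N] = 1`, so `ns(θ)^{Nk} = 1` for some `k`, so `[θ] = 1`. [cite: MochizukiFrdII2008, Thm 3.6 (v) p.37] -/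
theorem eq_one_of_isOfFinOrder (u : unitsSubgroup (pfStr π hF) X) (hfin : IsOfFinOrder u) : u = 1 := by
  obtain ⟨N, hN, hpow⟩ := (isOfFinOrder_iff_pow_eq_one).mp hfin
  obtain ⟨c, θ, hθ, e⟩ := exists_unit_rep X u.1 u.2
  have hu : classAut X c θ = u.1 := Iso.ext e
  have h1 : classAut X c (θ ^ N) = 1 := by
    rw [classAut_pow, hu, ← Subgroup.coe_pow, hpow, Subgroup.coe_one]
  obtain ⟨k, hk⟩ := (classAut_eq_one_iff X c (θ ^ N) (pow_mem hθ N)).mp h1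
  rw [normScalar_pow X c θ hθ, ← pow_mul] at hk
  have h2 : classAut X c θ = 1 :=
    (classAut_eq_one_iff X c θ hθ).mpr ⟨⟨N * k, Nat.mul_pos hN k.pos⟩, hk⟩
  exact Subtype.ext (hu.symm.trans h2)

/-- **Over a complex `A`, `O^×((A, n))` is nontrivial**: at a naively isotropic Frobenius power
`A^{(c)}` the unit with (normalised) scalar `exp(i)` — a point of infinite order of `S¹` — has
nontrivial class. [cite: MochizukiFrdII2008, Thm 3.6 (v) p.37] -/
theorem unitsSubgroup_ne_bot_of_isComplex (hX : (π.obj X.obj.snd).IsComplex) :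
    unitsSubgroup (pfStr π hF) X ≠ ⊥ := by
  obtain ⟨n₀, hn₀⟩ := exists_isotropic_levels X
  have hiso := hn₀ n₀ dvd_rfl
  have hcx := isComplexObj_frobPow X hX n₀
  have hz : ‖((D0.galAct (levelTwist X n₀) (Circle.toUnits (Circle.exp 1)) : ℂˣ) : ℂ)‖ = 1 := by
    rw [D0.norm_galAct]; exact norm_coe_circle_toUnits _
  have hθ := unitAutOver_mem π (frobPow hF X.obj n₀) hiso hcx _ hz
  intro hbot
  have h1 : classAut X n₀ (unitAutOver π (frobPow hF X.obj n₀) hiso hcx _ hz) = 1 :=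
    (Subgroup.eq_bot_iff_forall _).mp hbot _ (classAut_mem X n₀ _ hθ)
  obtain ⟨k, hk⟩ := (classAut_eq_one_iff X n₀ _ hθ).mp h1
  have hns : normScalar X n₀ (unitAutOver π (frobPow hF X.obj n₀) hiso hcx _ hz) =
      Circle.toUnits (Circle.exp 1) :=
    D0.galAct_galAct _ _
  rw [hns, ← map_pow, ← map_one Circle.toUnits] at hk
  have hk' : Circle.exp 1 ^ (k : ℕ) = 1 :=
    Circle.ext (by
      have := congrArg (fun u : ℂˣ => (u : ℂ)) hk
      simpa only [Circle.toUnits_apply, Units.val_mk0] using this)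
  exact circleExp_one_pow_ne_one k k.pos hk'

/-! ### The value of a unit in `S¹ ⊗_ℤ ℚ` -/

/-- `levelVal` is invariant under transport to a higher level. [cite: MochizukiFrdII2008, Thm 3.6 (v) p.37] -/
theorem levelVal_liftUnit {c c' : ℕ+} (h : c ∣ c') (θ : Aut (frobPow hF X.obj c))
    (hθ : θ ∈ unitsSubgroup (C.toElem π) (frobPow hF X.obj c)) :
    levelVal X c' (liftUnit X h θ) = levelVal X c θ := by
  unfold levelVal
  rw [normScalar_liftUnit X h θ hθ, unitCirc_pow (norm_normScalar X c θ hθ), ofMul_pow,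
    ← natCast_zsmul, zsmul_tmul_eq]
  congr 1
  have hk : ((c : ℕ) : ℚ) * (C0.degFr (frobTrans hF X.obj h).fst : ℕ) = (c' : ℕ) := by
    have := congrArg (fun n : ℕ+ => ((n : ℕ) : ℚ)) (mul_degFr_frobTrans X h)
    simpa only [PNat.mul_coe, Nat.cast_mul] using this
  have hc : ((c : ℕ) : ℚ) ≠ 0 := by exact_mod_cast c.ne_zero
  have hc' : ((c' : ℕ) : ℚ) ≠ 0 := by exact_mod_cast c'.ne_zero
  rw [Int.cast_natCast, ← hk, mul_inv, ← mul_assoc, mul_comm _ (((c : ℕ) : ℚ)⁻¹), mul_assoc,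
    mul_inv_cancel₀ (by
      intro h0
      rw [h0, mul_zero] at hk
      exact hc' hk.symm), mul_one]

/-- Units with the same class have the same value. [cite: MochizukiFrdII2008, Thm 3.6 (v) p.37] -/
theorem levelVal_eq_of_classAut_eq {c c' : ℕ+} (θ : Aut (frobPow hF X.obj c))
    (θ' : Aut (frobPow hF X.obj c')) (hθ : θ ∈ unitsSubgroup (C.toElem π) (frobPow hF X.obj c))
    (hθ' : θ' ∈ unitsSubgroup (C.toElem π) (frobPow hF X.obj c'))
    (h : classAut X c θ = classAut X c' θ') : levelVal X c θ = levelVal X c' θ' := by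
  have e := congrArg Iso.hom h
  change endClass X c θ.hom = endClass X c' θ'.hom at e
  obtain ⟨c'', hc, hc', e'⟩ := (endClass_eq_iff X θ.hom θ'.hom).mp e
  have e'' : liftUnit X hc θ = liftUnit X hc' θ' := Iso.ext e'
  rw [← levelVal_liftUnit X hc θ hθ, ← levelVal_liftUnit X hc' θ' hθ', e'']

/-- `unitVal` is computed by ANY level representative. [cite: MochizukiFrdII2008, Thm 3.6 (v) p.37] -/
theorem unitVal_eq (u : unitsSubgroup (pfStr π hF) X) {c : ℕ+} (θ : Aut (frobPow hF X.obj c))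
    (hθ : θ ∈ unitsSubgroup (C.toElem π) (frobPow hF X.obj c)) (h : classAut X c θ = u.1) :
    unitVal X u = levelVal X c θ := by
  obtain ⟨hθ₀, hcl⟩ := (exists_unit_rep X u.1 u.2).choose_spec.choose_spec
  unfold unitVal
  refine levelVal_eq_of_classAut_eq X _ _ hθ₀ hθ ?_
  rw [h]
  exact Iso.ext hcl

/-- `unitVal 1 = 0`. [cite: MochizukiFrdII2008, Thm 3.6 (v) p.37] -/
theorem unitVal_one : unitVal X 1 = 0 := by
  rw [unitVal_eq X 1 (1 : Aut (frobPow hF X.obj 1)) (one_mem _) (classAut_one X 1)]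
  unfold levelVal
  rw [normScalar_one, unitCirc_one, ofMul_one, TensorProduct.zero_tmul]

/-- `unitVal` is a homomorphism (compute both classes at a common level). [cite: MochizukiFrdII2008, Thm 3.6 (v) p.37] -/
theorem unitVal_mul (u v : unitsSubgroup (pfStr π hF) X) :
    unitVal X (u * v) = unitVal X u + unitVal X v := by
  obtain ⟨c₁, θ₁, h₁, e₁⟩ := exists_unit_rep X u.1 u.2
  obtain ⟨c₂, θ₂, h₂, e₂⟩ := exists_unit_rep X v.1 v.2
  have hd₁ : c₁ ∣ c₁ * c₂ := dvd_mul_right _ _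
  have hd₂ : c₂ ∣ c₁ * c₂ := dvd_mul_left _ _
  have m₁ := liftUnit_mem X hd₁ θ₁ h₁
  have m₂ := liftUnit_mem X hd₂ θ₂ h₂
  have hu : classAut X (c₁ * c₂) (liftUnit X hd₁ θ₁) = u.1 := by
    rw [classAut_liftUnit]; exact Iso.ext e₁
  have hv : classAut X (c₁ * c₂) (liftUnit X hd₂ θ₂) = v.1 := by
    rw [classAut_liftUnit]; exact Iso.ext e₂
  have huv : classAut X (c₁ * c₂) (liftUnit X hd₁ θ₁ * liftUnit X hd₂ θ₂) = (u * v).1 := by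
    rw [classAut_mul, hu, hv]; rfl
  rw [unitVal_eq X (u * v) _ (mul_mem m₁ m₂) huv, unitVal_eq X u _ m₁ hu, unitVal_eq X v _ m₂ hv]
  unfold levelVal
  rw [normScalar_mul X _ _ _ m₁ m₂, unitCirc_mul (norm_normScalar X _ _ m₁) (norm_normScalar X _ _ m₂),
    ofMul_mul, TensorProduct.add_tmul]

/-- `unitVal` has trivial kernel. [cite: MochizukiFrdII2008, Thm 3.6 (v) p.37] -/
theorem eq_one_of_unitVal_eq_zero (u : unitsSubgroup (pfStr π hF) X) (h : unitVal X u = 0) : u = 1 := by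
  obtain ⟨c, θ, hθ, e⟩ := exists_unit_rep X u.1 u.2
  have hu : classAut X c θ = u.1 := Iso.ext e
  rw [unitVal_eq X u θ hθ hu] at h
  obtain ⟨N, hN⟩ := exists_pnat_smul_eq_zero_of_tmul_eq_zero _
    (inv_ne_zero (by exact_mod_cast c.ne_zero)) h
  rw [natCast_zsmul, ← ofMul_pow, ofMul_eq_zero, ← unitCirc_pow (norm_normScalar X c θ hθ),
    unitCirc_eq_one_iff (by rw [Units.val_pow_eq_pow_val, norm_pow, norm_normScalar X c θ hθ, one_pow])]
    at hN
  exact Subtype.ext (hu.symm.trans ((classAut_eq_one_iff X c θ hθ).mpr ⟨N, hN⟩))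

/-- Every `y ⊗ (1/b)` is a value (use a naively isotropic level `c = b · n₀` and the unit with
normalised scalar `y^{n₀}`). [cite: MochizukiFrdII2008, Thm 3.6 (v) p.37] -/
theorem exists_unitVal_eq_tmul (hX : (π.obj X.obj.snd).IsComplex) (y : Additive Circle) (b : ℕ+) :
    ∃ u : unitsSubgroup (pfStr π hF) X, unitVal X u = y ⊗ₜ[ℤ] ((b : ℚ)⁻¹) := by
  obtain ⟨n₀, hn₀⟩ := exists_isotropic_levels X
  have hiso := hn₀ (b * n₀) (dvd_mul_left n₀ b)
  have hcx := isComplexObj_frobPow X hX (b * n₀)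
  have hz : ‖((D0.galAct (levelTwist X (b * n₀))
      (Circle.toUnits ((Additive.toMul y) ^ (n₀ : ℕ))) : ℂˣ) : ℂ)‖ = 1 := by
    rw [D0.norm_galAct]; exact norm_coe_circle_toUnits _
  have hθ := unitAutOver_mem π (frobPow hF X.obj (b * n₀)) hiso hcx _ hz
  refine ⟨⟨classAut X (b * n₀) _, classAut_mem X (b * n₀) _ hθ⟩, ?_⟩
  rw [unitVal_eq X _ _ hθ rfl]
  unfold levelVal
  have hns : normScalar X (b * n₀) (unitAutOver π (frobPow hF X.obj (b * n₀)) hiso hcx _ hz) =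
      Circle.toUnits ((Additive.toMul y) ^ (n₀ : ℕ)) :=
    D0.galAct_galAct _ _
  rw [hns, unitCirc_toUnits, ofMul_pow, ofMul_toMul, ← natCast_zsmul,
    tmul_inv_eq_smul_tmul_inv y b n₀]

/-- `unitVal` is surjective onto `S¹ ⊗_ℤ ℚ` for `A` complex. [cite: MochizukiFrdII2008, Thm 3.6 (v) p.37] -/
theorem unitVal_surjective (hX : (π.obj X.obj.snd).IsComplex) : Function.Surjective (unitVal X) := by
  intro t
  induction t using TensorProduct.induction_on with
  | zero => exact ⟨1, unitVal_one X⟩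
  | tmul y q =>
    obtain ⟨u, hu⟩ := exists_unitVal_eq_tmul X hX (q.num • y) ⟨q.den, q.den_pos⟩
    refine ⟨u, ?_⟩
    rw [hu, zsmul_tmul_eq]
    congr 1
    rw [PNat.mk_coe, ← div_eq_mul_inv, Rat.num_div_den]
  | add s t hs ht =>
    obtain ⟨u, hu⟩ := hs
    obtain ⟨w, hw⟩ := ht
    exact ⟨u * w, by rw [unitVal_mul, hu, hw]⟩

end Complex

variable {D : Type u} [Category.{v} D] (π : D ⥤ D0)

open PreFrobenioid PreFrobenioid.Perfection

/-- In `O^×((A, n))` (THE perfection of the archimedean Frobenioid `C`), the only torsion element is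
`1`, for every `A` (real: the group is trivial; complex: it is torsion-free). [cite: MochizukiFrdII2008, Thm 3.6 (v) p.37] -/
theorem torsion_subset_one (hF : PreFrobenioid.IsFrobenioid (C.toElem π)) (X : pfCat π hF) :
    {u : unitsSubgroup (pfStr π hF) X | IsOfFinOrder u} ⊆ {1} := fun u hu =>
  Set.mem_singleton_iff.mpr (eq_one_of_isOfFinOrder X u hu)

/-- **Theorem 3.6 (v) for `C^ℚ = C^pf`** (FrdII p. 37), ALL SIX CLAUSES at `Λ = ℚ` over THE perfection
of the archimedean Frobenioid `C → F_Φ` — PROVED: for `X = (A, n) ∈ Ob(C^pf)`, `O^×(X)` is trivial iff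
`A` is real ((b) "`Λ = ℚ` and `A` is real"); nontrivial and torsion-free iff `A` is complex, "and in fact
isomorphic to `S¹ ⊗_ℤ ℚ`"; never of order two; never with infinitely many torsion elements (the `Λ = ℤ`
clauses); the `Λ = ℤ` bracket `≅ S¹` is vacuous.  Mechanism: `O^×((A, n)) = lim_→ O^×(A^{(c)})` over the
Frobenius powers `A^{(c)}` of `A` ([FrdI] Def. 3.1 (ii)(iii)), with transition maps `z ↦ z^{c′/c}` on
(normalised) scalars; the levels are `{±1}` (real) resp. `S¹` (complex, naively isotropic — cofinal by
Lemma 3.2 (v)).  Closes the slot `Thm36Sub.v_Q` for every value of its parameter `hF` (the input of the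
construction of `C^pf`, print's "`C` is a Frobenioid"), i.e. the `Λ = ℚ` conjunct of abc-iut-L1-t9's
instance `Thm36v_C` at `pf := pfCompletion hF`. [cite: MochizukiFrdII2008, Thm 3.6 (v) p.37] -/
theorem v_Q_holds (hF : PreFrobenioid.IsFrobenioid (C.toElem π)) :
    Literature.AlgebraicGeometry.Frobenioids.ArchFrd.Thm36Sub.v_Q π hF := by
  refine ⟨fun X => ?_, fun X => ?_, fun _ X hc => ?_, fun X => ?_, fun X => ?_, fun h => absurd h (by decide)⟩
  · -- "trivial iff (a) ∨ (b) ∨ (c)": at `Λ = ℚ` only (b) "`A` real"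
    constructor
    · intro hbot
      refine Or.inr (Or.inl ⟨rfl, (realObjects_pf_iff π hF X).mpr ?_⟩)
      by_contra hr
      have hc : (π.obj X.obj.snd).IsComplex := (D0.isReal_or_isComplex _).resolve_left hr
      exact unitsSubgroup_ne_bot_of_isComplex X hc hbot
    · rintro (⟨h, -⟩ | ⟨-, hr⟩ | h)
      · cases h
      · exact unitsSubgroup_eq_bot_of_isReal X ((realObjects_pf_iff π hF X).mp hr)
      · cases h
  · -- "nontrivial and torsion-free iff `Λ = ℚ` and `A` complex"
    constructor
    · rintro ⟨hne, -⟩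
      refine ⟨rfl, (complexObjects_pf_iff π hF X).mpr ?_⟩
      by_contra hc
      exact hne (unitsSubgroup_eq_bot_of_isReal X (UnitStab.isReal_of_not_isComplex π X.obj hc))
    · rintro ⟨-, hc⟩
      exact ⟨unitsSubgroup_ne_bot_of_isComplex X ((complexObjects_pf_iff π hF X).mp hc),
        fun u hu => eq_one_of_isOfFinOrder X u hu⟩
  · -- "[and in fact isomorphic to `S¹ ⊗_ℤ ℚ`]"
    have hc' : (π.obj X.obj.snd).IsComplex := (complexObjects_pf_iff π hF X).mp hc
    exact ⟨AddEquiv.ofBijective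
      (AddMonoidHom.mk' (fun u => unitVal X (Additive.toMul u)) fun _ _ => unitVal_mul X _ _)
      ⟨(injective_iff_map_eq_zero _).mpr fun u hu =>
          Additive.toMul.injective (eq_one_of_unitVal_eq_zero X (Additive.toMul u) hu),
        fun t => by
          obtain ⟨u, hu⟩ := unitVal_surjective X hc' t
          exact ⟨Additive.ofMul u, hu⟩⟩⟩
  · -- "of order two iff `Λ = ℤ` and `A` real": never, at `Λ = ℚ`
    constructor
    · intro h2
      exfalso
      haveI : Finite (unitsSubgroup (pfStr π hF) X) := Nat.finite_of_card_ne_zero (by rw [h2]; decide)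
      have hbot : unitsSubgroup (pfStr π hF) X = ⊥ :=
        (Subgroup.eq_bot_iff_forall _).mpr fun u hu =>
          congrArg Subtype.val (eq_one_of_isOfFinOrder X ⟨u, hu⟩ (isOfFinOrder_of_finite _))
      rw [hbot, Subgroup.card_bot] at h2
      exact absurd h2 (by decide)
    · rintro ⟨h, -⟩
      cases h
  · -- "infinitely many torsion elements iff `Λ = ℤ` and `A` complex isotropic": never, at `Λ = ℚ`
    constructor
    · intro hinf
      exact absurd ((Set.finite_singleton _).subset (torsion_subset_one π hF X)) hinf
    · rintro ⟨h, -⟩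
      cases h

/-- The `Λ = ℚ` conjuncts of abc-iut-L1-t9's instance statement `Thm36v_C π (pfCompletion hF) rlf`
(`ArchimedeanTheoremsInstances.lean`) hold — they ARE `v_Q hF` (`archFrobenioid_pfCompletion_Q_str`).
[cite: MochizukiFrdII2008, Thm 3.6 (v) p.37] -/
theorem thm36v_instance_Q (hF : PreFrobenioid.IsFrobenioid (C.toElem π)) (rlf : LambdaCompletion π) :
    Thm36v_trivial (baseRC π) (archFrobenioid π (pfCompletion π hF) rlf .Q).str .Q ∧
      Thm36v_torsionFree (baseRC π) (archFrobenioid π (pfCompletion π hF) rlf .Q).str .Q ∧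
      Thm36v_isoCircleTensorRat (baseRC π) (archFrobenioid π (pfCompletion π hF) rlf .Q).str .Q ∧
      Thm36v_orderTwo (baseRC π) (archFrobenioid π (pfCompletion π hF) rlf .Q).str .Q ∧
      Thm36v_torsion (baseRC π) (archFrobenioid π (pfCompletion π hF) rlf .Q).str .Q ∧
      Thm36v_isoCircle (baseRC π) (archFrobenioid π (pfCompletion π hF) rlf .Q).str .Q :=
  v_Q_holds π hF

end Thm36Sub

end ArchFrd

end Literature.AlgebraicGeometry.Frobenioids

end
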